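import Summits.QuantumFields.BalabanUV.Beta.EriceFlowEnclosureB12AsPrintedHistoryContagionProfile
import Summits.QuantumFields.BalabanUV.Beta.EriceFlowEnclosureB12AsPrintedPointwiseFadingOrder

/-!
# Beta / EriceFlowEnclosureB12AsPrintedHistoryContagionOrder — ASYMPTOTIC FREEDOM IS CONTAGIOUS, part 5 (junction with prover 2's ORDER theorem):
# in a box of ANY size against the modulus, ONE reference run confines every small-endpoint run below twice its endpoint (part 2), and on
# that small box prover 2's forward order argument (`…PointwiseFadingOrder.order_preserved`, gen 44) applies — so among the rows of the big box
# ending near zero the renormalized coupling is a STRICTLY INCREASING function of the bare coupling (β-flow team, prover 1 = recursion ∕ upper ∕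
# bare-coupling ∕ UNIQUENESS side, unit `b2b-balaban-beta-bflow-p1`, gen 35; ROW AP-I·U, fourth reading; parts 1–4 `…HistoryContagion*`; sibling
# `…PointwiseFadingOrder` (prover 2, gen 44, the same day): order and sign-free uniqueness in a SMALL box `4Cγ³ ≤ (1 − θ)²`, reference-free)

HONEST FRAMING (page 1 of everything the β sub-cell writes): discharging `BetaPertH` makes Bałaban's UV stability UNCONDITIONAL — a
real constructive-QFT result; it is NOT the continuum limit and NOT the Clay problem.  HONEST DEPENDENCY (cell reorg 2026-08-19,
verbatim): «continuum YM on T⁴ ⇐ BetaPertH ∧ nine spine estimates (0/9 proved); BetaPertH ⇐ (D1) ∧ (D4) ∧ CAP+tail; G-an2-4 gates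
asym, D1 and NE2/3/4.»  THIS MODULE DISCHARGES NOTHING: a junction of two landed kernels BY NAME over runs of the printed recursion (0.20) of
[I] = T. Bałaban, Commun. Math. Phys. **109** (1987) [Balaban1987RG1] for a history-dependent β on an abstract `Setting` (`B12BetaAsPrinted`;
Theorem 2 is STATED WITHOUT PROOF, p. 259, and consumed AS TYPED as a hypothesis) under node U2's HYPOTHESIS SHAPES
`T4CouplingMatching.HistLipschitz ∕ FadingMemory` (NOT printed, [I] p. 298).  Nothing of Bałaban's β is asserted.

THE POINT.  Prover 2's `order_preserved` (gen 44): two same-depth runs inside a box ]0, δ] with `4Cδ³ ≤ (1 − θ)²` keep the order of their bare couplings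
at every scale.  In a LARGE box (Cγ³ big) this is false in general — part 4's Markov fold has two bare couplings 1 > ½ meeting at scale 1 — unless
something keeps the runs small: part 2's contagion does, given ONE reference run carrying (0.31)'s lower half from its end (every run ending at
e below the threshold stays below 2e).  Hence (§8 `order_preserved_bigBox_of_reference`): two runs of the same depth in ]0, γ], γ ARBITRARY, ending
below e₁ with `32Ce₁³ ≤ (1 − θ)²` and below part 2's threshold, satisfy g_0 < g′_0 ⟹ g_j < g′_j at every scale; on the carrier, from
`Theorem2Statement` AS TYPED + `Definitions` + `hrg` + the moduli on ]0, γ_u] (§9 **`bare_lt_iff_renormalized_lt_bigBox`**): for every m some g₂ > 0 such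
that for ANY two rows (K, m, g₀), (K, m, g₀′) in the WHOLE box ]0, γ_u] with endpoints ≤ g₂, **g₀ < g₀′ ⟺ g_K < g′_K** — «g₀ = g₀(ε, g)» is, near zero,
a strictly increasing function of g among all rows of the box, whatever the box.

WHAT THIS FILE PROVES (0 sorry, 0 def): §8 **`order_preserved_bigBox_of_reference`**; §9 `bareCoupling_strictMono_bigBox`, **`bare_lt_iff_renormalized_lt_bigBox`**.
NOT CLAIMED: any modulus, sign or bound for Bałaban's β; Theorem 2; `BetaPertH`; continuum; Clay.
-/

namespace Summit.QuantumFields.BalabanUV.Beta.EriceFlowEnclosureB12AsPrintedHistoryContagionOrder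

open Finset
open Literature.MathematicalPhysics.QuantumFieldTheory.Balaban1983to89
open Literature.MathematicalPhysics.QuantumFieldTheory.Balaban1983to89.B12BetaAsPrinted
open Literature.MathematicalPhysics.QuantumFieldTheory.Balaban1983to89.FlowStep (prefixOf Box mem_box box_mono RGEqH)
open Literature.MathematicalPhysics.QuantumFieldTheory.Balaban1983to89.T4CouplingMatching (HistLipschitz FadingMemory)
open Summit.QuantumFields.BalabanUV.Beta.EriceFlowEnclosureB12AsPrintedUpper (tunedRuns_of_theorem2Statement)
open Summit.QuantumFields.BalabanUV.Beta.EriceFlowEnclosureB12AsPrintedHistoryContagionProfile (le_two_mul_end_of_reference threshold_exists)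
open Summit.QuantumFields.BalabanUV.Beta.EriceFlowEnclosureB12AsPrintedPointwiseFadingOrder (order_preserved)

noncomputable section

variable {S : Setting}

/-! ## §8 Order among small-endpoint runs of a big box -/

/-- **ORDER IS PRESERVED AMONG THE SMALL-ENDPOINT RUNS OF A BOX OF ANY SIZE.**  Moduli `HistLipschitz Λ γ S.β`, `FadingMemory C θ Λ` (0 ≤ θ < 1, C ≥ 0) on a box
]0, γ] of ANY size; ONE reference run t of (0.20) of depth K in ]0, γ] with (0.31)'s lower half from its end at rate β* > 0; two runs g, g′ of (0.20) of depth K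
in ]0, γ] whose endpoints lie below e₁, where `32Ce₁³ ≤ (1 − θ)²` and both endpoints meet part 2's threshold (`4Ce ≤ β*(1 − θ)`, `e²Q ≤ 3∕4`).  Then
g_0 < g′_0 ⟹ g_j < g′_j for every j ≤ K: part 2 confines both runs to ]0, 2e₁] (`le_two_mul_end_of_reference`), where prover 2's `order_preserved` applies
with `4C(2e₁)³ ≤ (1 − θ)²`. [cite: Balaban1987RG1, Thm 2 p.259 («g₀ = g₀(ε, g)») with (0.20) p.256 and p.298] -/
theorem order_preserved_bigBox_of_reference {γ θ C bs e₁ : ℝ} {Λ : ℕ → ℕ → ℝ} {K : ℕ} {g g' t : ℕ → ℝ}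
    (hθ0 : 0 ≤ θ) (hθ1 : θ < 1) (hC : 0 ≤ C) (hbs : 0 < bs)
    (hL : HistLipschitz Λ γ S.β) (hΛ : FadingMemory C θ Λ)
    (hg : RGEqH K S.β g) (hg' : RGEqH K S.β g') (ht : RGEqH K S.β t)
    (hbox : ∀ i, i ≤ K → 0 < g i ∧ g i ≤ γ) (hbox' : ∀ i, i ≤ K → 0 < g' i ∧ g' i ≤ γ)
    (hboxt : ∀ i, i ≤ K → 0 < t i ∧ t i ≤ γ)
    (h031 : ∀ i, i ≤ K → 1 / (t K) ^ 2 + bs * ((K : ℝ) - i) ≤ 1 / (t i) ^ 2)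
    (he : g K ≤ e₁) (he' : g' K ≤ e₁) (he₁ : 32 * C * e₁ ^ 3 ≤ (1 - θ) ^ 2)
    (hs1 : 4 * C * g K ≤ bs * (1 - θ))
    (hs2 : (g K) ^ 2 * (C * γ / (1 - θ) ^ 2 + C / (1 - θ) * t K + (2 * C / ((1 - θ) * bs)) ^ 2 + 1 / (4 * (t K) ^ 2)) ≤ 3 / 4)
    (hs1' : 4 * C * g' K ≤ bs * (1 - θ))
    (hs2' : (g' K) ^ 2 * (C * γ / (1 - θ) ^ 2 + C / (1 - θ) * t K + (2 * C / ((1 - θ) * bs)) ^ 2 + 1 / (4 * (t K) ^ 2)) ≤ 3 / 4)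
    (h0 : g 0 < g' 0) : ∀ j, j ≤ K → g j < g' j := by
  have hA := le_two_mul_end_of_reference hθ0 hθ1 hC hbs hL hΛ hg ht hbox hboxt h031 hs1 hs2
  have hB := le_two_mul_end_of_reference hθ0 hθ1 hC hbs hL hΛ hg' ht hbox' hboxt h031 hs1' hs2'
  -- both runs lie in ]0, 2e₁] ⊆ ]0, γ]
  have hboxA : ∀ i, i ≤ K → 0 < g i ∧ g i ≤ min γ (2 * e₁) := fun i hi =>
    ⟨(hbox i hi).1, le_min (hbox i hi).2 ((hA i hi).trans (by linarith))⟩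
  have hboxB : ∀ i, i ≤ K → 0 < g' i ∧ g' i ≤ min γ (2 * e₁) := fun i hi =>
    ⟨(hbox' i hi).1, le_min (hbox' i hi).2 ((hB i hi).trans (by linarith))⟩
  have hLδ : HistLipschitz Λ (min γ (2 * e₁)) S.β := fun k p q hp hq =>
    hL k p q (box_mono (min_le_left _ _) k hp) (box_mono (min_le_left _ _) k hq)
  have hδpos : 0 < min γ (2 * e₁) := lt_of_lt_of_le (hboxA 0 (Nat.zero_le _)).1 (hboxA 0 (Nat.zero_le _)).2
  have hsmall : 4 * C * (min γ (2 * e₁)) ^ 3 ≤ (1 - θ) ^ 2 := by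
    have h1 : (min γ (2 * e₁)) ^ 3 ≤ (2 * e₁) ^ 3 := pow_le_pow_left₀ hδpos.le (min_le_right _ _) 3
    nlinarith [mul_le_mul_of_nonneg_left h1 (by positivity : (0 : ℝ) ≤ 4 * C)]
  exact order_preserved hθ0 hθ1 hC hg hg' hboxA hboxB hLδ hΛ hsmall h0

/-! ## §9 On the carrier: the renormalized coupling is a strictly increasing function of the bare coupling, among all rows of the box -/

/-- **STRICT MONOTONICITY AMONG ALL ROWS OF THE BOX, FROM REFERENCE ROWS AT ONE ENDPOINT.**  Data: reference rows (K, m′, t₀) at every depth inside ]0, γ] ending at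
g₁ with (0.31)'s lower half at rate b > 0; `hrg` and the moduli on ]0, γ] (γ arbitrary, 0 ≤ θ < 1); `Definitions`.  Then there is g₂ > 0 such that for two rows
(K, m, g₀), (K, m, g₀′) lying anywhere in ]0, γ] with BOTH endpoints ≤ g₂: g₀ < g₀′ ⟹ g_j < g′_j at every j ≤ K. [cite: Balaban1987RG1, Thm 2 p.259 («g₀ = g₀(ε, g)») with (0.18)–(0.20) pp.255–256 and p.298] -/
theorem bareCoupling_strictMono_bigBox (hD : Definitions S) {m m' : ℕ} {γ g₁ b θ C : ℝ} {Λ : ℕ → ℕ → ℝ}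
    (hθ0 : 0 ≤ θ) (hθ1 : θ < 1) (hC : 0 ≤ C) (hb : 0 < b)
    (hrg : ∀ P : B12.RunParams, Step.InInterval γ P.K (S.cpl P) → RGEqH P.K S.β (S.cpl P))
    (hL : HistLipschitz Λ γ S.β) (hΛ : FadingMemory C θ Λ)
    (hT : ∀ K : ℕ, ∃ t₀ : ℝ, Step.InInterval γ K (S.cpl ⟨K, m', t₀⟩) ∧ S.cpl ⟨K, m', t₀⟩ K = g₁ ∧
      ∀ i, i ≤ K → 1 / g₁ ^ 2 + b * ((K : ℝ) - i) ≤ 1 / (S.cpl ⟨K, m', t₀⟩ i) ^ 2) :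
    ∃ g₂ : ℝ, 0 < g₂ ∧ ∀ (K : ℕ) (g₀ g₀' : ℝ), Step.InInterval γ K (S.cpl ⟨K, m, g₀⟩) →
      Step.InInterval γ K (S.cpl ⟨K, m, g₀'⟩) → S.cpl ⟨K, m, g₀⟩ K ≤ g₂ → S.cpl ⟨K, m, g₀'⟩ K ≤ g₂ → g₀ < g₀' →
        ∀ j, j ≤ K → S.cpl ⟨K, m, g₀⟩ j < S.cpl ⟨K, m, g₀'⟩ j := by
  have h1θ : 0 < 1 - θ := by linarith
  obtain ⟨e₀, he₀, hthr⟩ := threshold_exists (γ := γ) g₁ hθ1 hC hb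
  -- e₁ with 32 C e₁³ ≤ (1 − θ)²: e₁ := min 1 ((1 − θ)² ∕ (32C + 1))
  set e₁ : ℝ := min 1 ((1 - θ) ^ 2 / (32 * C + 1)) with he₁
  have he₁pos : 0 < e₁ := lt_min one_pos (by positivity)
  have he₁1 : e₁ ≤ 1 := min_le_left _ _
  have he₁r : e₁ ≤ (1 - θ) ^ 2 / (32 * C + 1) := min_le_right _ _
  have he₁c : 32 * C * e₁ ^ 3 ≤ (1 - θ) ^ 2 := by
    have hcube : e₁ ^ 3 ≤ e₁ := by nlinarith [mul_le_mul_of_nonneg_left he₁1 he₁pos.le]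
    rw [le_div_iff₀ (by positivity)] at he₁r
    nlinarith
  refine ⟨min e₀ e₁, lt_min he₀ he₁pos, fun K g₀ g₀' hI hI' hle hle' hlt j hj => ?_⟩
  obtain ⟨t₀, hIt, hendt, h031t⟩ := hT K
  have h031 : ∀ i, i ≤ K → 1 / (S.cpl ⟨K, m', t₀⟩ K) ^ 2 + b * ((K : ℝ) - i) ≤ 1 / (S.cpl ⟨K, m', t₀⟩ i) ^ 2 := by
    intro i hi
    rw [hendt]
    exact h031t i hi
  obtain ⟨hs1, hs2, -⟩ := hthr (S.cpl ⟨K, m, g₀⟩ K) (hI K le_rfl).1 (hle.trans (min_le_left _ _))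
  obtain ⟨hs1', hs2', -⟩ := hthr (S.cpl ⟨K, m, g₀'⟩ K) (hI' K le_rfl).1 (hle'.trans (min_le_left _ _))
  rw [← hendt] at hs2 hs2'
  have h0 : S.cpl ⟨K, m, g₀⟩ 0 < S.cpl ⟨K, m, g₀'⟩ 0 := by rw [hD.d018, hD.d018]; exact hlt
  exact order_preserved_bigBox_of_reference hθ0 hθ1 hC hb hL hΛ (hrg ⟨K, m, g₀⟩ hI) (hrg ⟨K, m, g₀'⟩ hI') (hrg ⟨K, m', t₀⟩ hIt)
    hI hI' hIt h031 (hle.trans (min_le_right _ _)) (hle'.trans (min_le_right _ _)) he₁c hs1 hs2 hs1' hs2' h0 j hj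

/-- **«g₀ = g₀(ε, g)» IS STRICTLY INCREASING IN g NEAR ZERO, AMONG ALL ROWS OF THE BOX — from Theorem 2 AS TYPED.**  `Theorem2Statement S hL` ([I] Theorem 2 AS TYPED, a
HYPOTHESIS), `Definitions`, the binder `hrg` and the moduli `HistLipschitz Λ γ_u S.β`, `FadingMemory C θ Λ` (0 ≤ θ < 1, C ≥ 0) on a box ]0, γ_u] of ANY size ⟹ for
every m there is g₂ > 0 such that for ANY two rows (K, m, g₀), (K, m, g₀′) lying in the WHOLE box ]0, γ_u] with both endpoints ≤ g₂: **g₀ < g₀′ ⟺ g_K < g′_K**.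
Prover 2's `bare_lt_iff_renormalized_lt` (gen 44) confines the rows to ]0, γ] with `4Cγ³ ≤ (1 − θ)²`; here the reference row Theorem 2 supplies at one endpoint
does the confining. [cite: Balaban1987RG1, Thm 2 (0.31) p.259 with (0.18)–(0.20) pp.255–256 and p.298] -/
theorem bare_lt_iff_renormalized_lt_bigBox {hL : Odd S.L ∧ 1 < S.L} (h : Theorem2Statement S hL) (hD : Definitions S)
    {γu θ C : ℝ} {Λ : ℕ → ℕ → ℝ} (hγu : 0 < γu)
    (hrg : ∀ P : B12.RunParams, Step.InInterval γu P.K (S.cpl P) → RGEqH P.K S.β (S.cpl P))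
    (hL' : HistLipschitz Λ γu S.β) (hΛ : FadingMemory C θ Λ) (hθ0 : 0 ≤ θ) (hθ1 : θ < 1) (hC : 0 ≤ C) (m : ℕ) :
    ∃ g₂ : ℝ, 0 < g₂ ∧ ∀ (K : ℕ) (g₀ g₀' : ℝ), Step.InInterval γu K (S.cpl ⟨K, m, g₀⟩) →
      Step.InInterval γu K (S.cpl ⟨K, m, g₀'⟩) → S.cpl ⟨K, m, g₀⟩ K ≤ g₂ → S.cpl ⟨K, m, g₀'⟩ K ≤ g₂ →
        (g₀ < g₀' ↔ S.cpl ⟨K, m, g₀⟩ K < S.cpl ⟨K, m, g₀'⟩ K) := by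
  obtain ⟨γ₀, hγ₀, hγ⟩ := tunedRuns_of_theorem2Statement h m
  obtain ⟨g₁, hg₁, hg⟩ := hγ (min γ₀ γu) (lt_min hγ₀ hγu) (min_le_left _ _)
  obtain ⟨β, β', hβ, -, hT⟩ := hg g₁ hg₁ le_rfl
  have hbs : 0 < β * Real.log S.L := mul_pos hβ (Real.log_pos (by exact_mod_cast hL.2))
  have hT' : ∀ K : ℕ, ∃ t₀ : ℝ, Step.InInterval γu K (S.cpl ⟨K, m, t₀⟩) ∧ S.cpl ⟨K, m, t₀⟩ K = g₁ ∧
      ∀ i, i ≤ K → 1 / g₁ ^ 2 + β * Real.log S.L * ((K : ℝ) - i) ≤ 1 / (S.cpl ⟨K, m, t₀⟩ i) ^ 2 := by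
    intro K
    obtain ⟨t₀, hIt, hendt, h031t⟩ := hT K
    exact ⟨t₀, fun i hi => ⟨(hIt i hi).1, (hIt i hi).2.trans (min_le_right _ _)⟩, hendt, fun i hi => (h031t i hi).1⟩
  obtain ⟨g₂, hg₂, hmono⟩ := bareCoupling_strictMono_bigBox (m := m) hD hθ0 hθ1 hC hbs hrg hL' hΛ hT'
  refine ⟨g₂, hg₂, fun K g₀ g₀' hI hI' hle hle' => ⟨fun hlt => hmono K g₀ g₀' hI hI' hle hle' hlt K le_rfl, fun hlt => ?_⟩⟩
  rcases lt_trichotomy g₀ g₀' with h1 | h2 | h3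
  · exact h1
  · subst h2; exact absurd hlt (lt_irrefl _)
  · exact absurd hlt (not_lt.mpr (hmono K g₀' g₀ hI' hI hle' hle h3 K le_rfl).le)

end

end Summit.QuantumFields.BalabanUV.Beta.EriceFlowEnclosureB12AsPrintedHistoryContagionOrder
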